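import Literature.NumberTheory.Sieve.PolymathMkEpsCauchySchwarz
import Literature.NumberTheory.Sieve.MaynardTaoProofs
import HarnessLib

/-!
# Polymath 8b Proposition 6.5: a two-zone weight family for `M_{k,ε}` and the bound `M_{k,ε} ≤ T_k(ε, τ)`

Topic `Literature/NumberTheory/Sieve`; second support file of the discharge of
`Literature.Barriers.Parity.Polymath2014_epsFunctional_le` (D. H. J. Polymath, *Variants of the Selberg
sieve, and bounded intervals containing many primes*, Res. Math. Sci. 1:12 (2014) = arXiv:1407.4897,
Proposition 6.5, pp. 24–25: `M_{k,ε} ≤ (k/(k-1)) log(2k-1)` for `k ≥ 2`, `0 ≤ ε < 1`).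

**Why a new weight.** The printed proof applies Cauchy–Schwarz on each fibre with the weight
`1 - t₁ - ⋯ - t_k + k tᵢ` of Corollary 6.4 and then "integrates and sums in `i`".  That last step needs
`∑ᵢ 1_{Eᵢ}(t) (1 - σ + k tᵢ) ≤ k` pointwise (`σ = ∑ tⱼ`, `Eᵢ = {∑_{j≠i} tⱼ ≤ 1-ε}`), which holds for `σ ≤ 1`
but FAILS on `1 < σ ≤ 1 + ε`, where the weights of the coordinates `i` with `t ∉ Eᵢ` are negative
(e.g. `k = 2`, `ε = 0.9`, `t = (1.8, 0.05)`: the multiplier is `2.75 > 2`); the printed weights only give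
`M_{k,ε} ≤ ((k + (k-1)ε)/(k-1)) log(2k-1)`.  We complete the argument with the following weights
(`η := 1 - ε`, a threshold `τ ∈ [η, 1]`, target `M`), for coordinate `m` at the point `t`:

* zone 1 (`σ ≤ τ`): `w_m(t) = (M/(kτ)) · (τ - σ + k t_m)` (Corollary 6.4's affine weight for the simplex `τ·R_k`;
  its sum over ALL `m` is `M`, and every term is `≥ 0`);
* counting zone (`σ > τ`): `w_m(t) = M / N_m(t)`, `N_m(t) = #{0 ≤ j < k : t_m + j(σ - η) ≤ σ}`.  If `n` coordinates
  are active at `t` (i.e. `t_i > 0`, `σ - t_i ≤ η`), each is `≥ σ - η > 0` and they sum to `≤ σ`, so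
  `N_m(t) ≥ n` for every active `m` and `∑_{active} w_m ≤ n · M/n = M` (`MkEps.sum_weight_le`).

Fibre budget over an outer point `s ≥ 0`, `ρ := ∑ s ≤ η` (`MkEps.lintegral_weight_inv_le`): zone 1 costs
`∫₀^{τ-ρ} kτ du/(M((τ-ρ) + (k-1)u)) = kτ log k/((k-1)M)` (`MaynardTao.integral_inv_add_mul`), and on the
counting zone `u ∈ (τ-ρ, 1+ε-ρ]` the `j`-th indicator in `N_m` lives on an interval of length
`≤ ℓ_j := (min(2ε, η/j) - (τ - η))₊` (`j ≥ 1`; `ℓ₀ = 1 + ε - τ`).  Hence (`polymathFunctional_le_epsT`)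

  `M_{k,ε} ≤ T_k(ε,τ) := (k/(k-1)) τ log k + (1 + ε - τ) + ∑_{j=1}^{k-1} (min(2ε, (1-ε)/j) - (τ - 1 + ε))₊`

for every `τ ∈ [1-ε, 1]`; `τ = 1` and `τ = 1 - ε` are the two regimes used in `PolymathMkEpsUpperBound.lean`
(`τ = 1`, `ε = 0` is Corollary 6.4 verbatim).  The weights are not definitions: each lemma takes the
closed formula as a hypothesis `hW : ∀ m t, W m t = …`.  Reference: [Polymath8b2014], op. cit.,
Lemma 6.1, Corollary 6.4, Proposition 6.5 (pp. 24–25).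
-/

noncomputable section

open MeasureTheory Set Filter Finset
open scoped ENNReal BigOperators

namespace Literature.NumberTheory.Sieve

namespace MkEps

/-! ### The counting function -/

/-- **The count dominates the number of active coordinates.**  Let `t ≥ 0`, `σ = ∑ tⱼ`, `0 ≤ σ - η`,
and let `A` be a set of coordinates each with `t_i ≥ σ - η`.  Then for `m ∈ A` and every `j < #A`,
`t_m + j (σ - η) ≤ σ`; hence `#A ≤ ∑_{j<k} 1[t_m + j(σ-η) ≤ σ]`. [cite: Polymath8b2014, Proposition 6.5 (proof, completed)] -/
theorem card_le_count {k : ℕ} {t : Fin k → ℝ} (ht : ∀ j, 0 ≤ t j) {η : ℝ}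
    (hση : 0 ≤ ∑ l, t l - η) {A : Finset (Fin k)} (hA : ∀ i ∈ A, ∑ l, t l - η ≤ t i) {m : Fin k}
    (hm : m ∈ A) :
    ((#A : ℕ) : ℝ) ≤ ∑ j ∈ Finset.range k,
      (if t m + (j : ℝ) * (∑ l, t l - η) ≤ ∑ l, t l then (1 : ℝ) else 0) := by
  classical
  set σ := ∑ l, t l with hσ
  -- the active coordinates carry mass at least `t_m + (#A - 1)(σ - η)` and at most `σ`
  have hAsum : ∑ i ∈ A, t i ≤ σ :=
    Finset.sum_le_sum_of_subset_of_nonneg (Finset.subset_univ A) fun i _ _ => ht i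
  have hAlow : t m + ((#A : ℕ) - 1 : ℝ) * (σ - η) ≤ ∑ i ∈ A, t i := by
    rw [← Finset.add_sum_erase A t hm]
    have h1 : ∑ i ∈ A.erase m, (σ - η) ≤ ∑ i ∈ A.erase m, t i :=
      Finset.sum_le_sum fun i hi => hA i (Finset.mem_of_mem_erase hi)
    rw [Finset.sum_const, nsmul_eq_mul, Finset.card_erase_of_mem hm, Nat.cast_sub
      (Finset.card_pos.2 ⟨m, hm⟩), Nat.cast_one] at h1
    linarith
  have hAk : #A ≤ k := by simpa using Finset.card_le_univ A
  calc ((#A : ℕ) : ℝ) = ∑ j ∈ Finset.range #A, (1 : ℝ) := by simp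
    _ ≤ ∑ j ∈ Finset.range #A,
          (if t m + (j : ℝ) * (σ - η) ≤ σ then (1 : ℝ) else 0) := by
        refine Finset.sum_le_sum fun j hj => ?_
        rw [if_pos]
        have hj' : (j : ℝ) ≤ (#A : ℕ) - 1 := by
          have := Finset.mem_range.1 hj
          have : (j : ℝ) + 1 ≤ (#A : ℕ) := by exact_mod_cast this
          linarith
        have : (j : ℝ) * (σ - η) ≤ ((#A : ℕ) - 1 : ℝ) * (σ - η) :=
          mul_le_mul_of_nonneg_right hj' hση
        linarith
    _ ≤ ∑ j ∈ Finset.range k, (if t m + (j : ℝ) * (σ - η) ≤ σ then (1 : ℝ) else 0) :=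
        Finset.sum_le_sum_of_subset_of_nonneg (Finset.range_subset_range.2 hAk)
          fun j _ _ => by split_ifs <;> norm_num

/-- The count is at least `1` (the term `j = 0`) as soon as `t_m ≤ σ`. [folklore] -/
theorem one_le_count {k : ℕ} (hk : 1 ≤ k) {t : Fin k → ℝ} {m : Fin k} (htm : t m ≤ ∑ l, t l) (η : ℝ) :
    (1 : ℝ) ≤ ∑ j ∈ Finset.range k,
      (if t m + (j : ℝ) * (∑ l, t l - η) ≤ ∑ l, t l then (1 : ℝ) else 0) := by
  obtain ⟨k', rfl⟩ : ∃ k', k = k' + 1 := ⟨k - 1, by omega⟩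
  rw [Finset.sum_range_succ']
  simp only [Nat.cast_zero, zero_mul, add_zero, if_pos htm]
  have : 0 ≤ ∑ j ∈ Finset.range k',
      (if t m + ((j + 1 : ℕ) : ℝ) * (∑ l, t l - η) ≤ ∑ l, t l then (1 : ℝ) else 0) :=
    Finset.sum_nonneg fun j _ => by split_ifs <;> norm_num
  linarith

/-! ### The pointwise bound -/

/-- **Pointwise bound for the two-zone weights** (the step the printed proof of Proposition 6.5 leaves
out): for `t ≥ 0` in `(1+ε)·R_{n+1}`, `0 < M`, `0 < τ`, `1 - ε ≤ τ`,
`∑_m 1[t_m > 0, ∑_{j≠m} t_j ≤ 1-ε] · w_m(t) ≤ M`.  Zone 1 (`σ ≤ τ`): all `k` affine terms are `≥ 0` and sum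
to `M`.  Counting zone: `card_le_count`. [cite: Polymath8b2014, Proposition 6.5 (proof, completed)] -/
theorem sum_weight_le {n : ℕ} {ε τ M : ℝ} (hM : 0 < M) (hτ0 : 0 < τ) (hητ : 1 - ε ≤ τ)
    (W : Fin (n + 1) → (Fin (n + 1) → ℝ) → ℝ)
    (hW : ∀ m t, W m t = if ∑ l, t l ≤ τ then
        M / (((n : ℝ) + 1) * τ) * (τ - ∑ l, t l + ((n : ℝ) + 1) * t m)
      else M / ∑ j ∈ Finset.range (n + 1),
        (if t m + (j : ℝ) * (∑ l, t l - (1 - ε)) ≤ ∑ l, t l then (1 : ℝ) else 0))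
    {t : Fin (n + 1) → ℝ} (ht : ∀ j, 0 ≤ t j) :
    ∑ m, (if 0 < t m ∧ ∑ j ∈ univ.erase m, t j ≤ 1 - ε then W m t else 0) ≤ M := by
  classical
  set σ := ∑ l, t l with hσ
  have herase : ∀ m : Fin (n + 1), ∑ j ∈ univ.erase m, t j = σ - t m := fun m =>
    Finset.sum_erase_eq_sub (Finset.mem_univ m)
  rcases le_or_gt σ τ with hστ | hστ
  · -- zone 1: every term is at most the (nonnegative) affine weight, and these sum to `M`
    have hWm : ∀ m, W m t = M / (((n : ℝ) + 1) * τ) * (τ - σ + ((n : ℝ) + 1) * t m) := fun m => by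
      rw [hW, if_pos hστ]
    have hnn : ∀ m, 0 ≤ W m t := fun m => by
      rw [hWm]
      have : 0 ≤ ((n : ℝ) + 1) * t m := mul_nonneg (by positivity) (ht m)
      exact mul_nonneg (by positivity) (by linarith)
    calc ∑ m, (if 0 < t m ∧ ∑ j ∈ univ.erase m, t j ≤ 1 - ε then W m t else 0)
        ≤ ∑ m, W m t := Finset.sum_le_sum fun m _ => by
          split_ifs
          · exact le_rfl
          · exact hnn m
      _ = M / (((n : ℝ) + 1) * τ) * ∑ m : Fin (n + 1), (τ - σ + ((n : ℝ) + 1) * t m) := by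
          rw [Finset.mul_sum]
          exact Finset.sum_congr rfl fun m _ => hWm m
      _ = M := by
          rw [Finset.sum_add_distrib, Finset.sum_const, Finset.card_univ, Fintype.card_fin,
            ← Finset.mul_sum, nsmul_eq_mul]
          push_cast
          field_simp
          ring
  · -- counting zone
    set A : Finset (Fin (n + 1)) := univ.filter fun m => 0 < t m ∧ ∑ j ∈ univ.erase m, t j ≤ 1 - ε
      with hA
    have hση : 0 ≤ σ - (1 - ε) := by linarith
    have hAi : ∀ i ∈ A, σ - (1 - ε) ≤ t i := fun i hi => by
      have h := (Finset.mem_filter.1 hi).2.2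
      rw [herase] at h
      linarith
    rw [← Finset.sum_filter]
    change ∑ m ∈ A, W m t ≤ M
    rcases A.eq_empty_or_nonempty with hA0 | hAne
    · rw [hA0, Finset.sum_empty]; exact hM.le
    have hcard : 0 < #A := Finset.card_pos.2 hAne
    have hcardR : (0 : ℝ) < (#A : ℕ) := by exact_mod_cast hcard
    have hWle : ∀ m ∈ A, W m t ≤ M / (#A : ℕ) := by
      intro m hm
      rw [hW, if_neg (not_le.2 hστ)]
      exact div_le_div_of_nonneg_left hM.le hcardR (card_le_count ht hση hAi hm)
    calc ∑ m ∈ A, W m t ≤ ∑ m ∈ A, M / (#A : ℕ) := Finset.sum_le_sum hWle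
      _ = M := by
          rw [Finset.sum_const, nsmul_eq_mul]
          field_simp

/-! ### Positivity and measurability -/

/-- The weights are positive wherever the fibre variable is: `t ≥ 0`, `t_m > 0`. [folklore] -/
theorem weight_pos {n : ℕ} {ε τ M : ℝ} (hM : 0 < M) (hτ0 : 0 < τ)
    (W : Fin (n + 1) → (Fin (n + 1) → ℝ) → ℝ)
    (hW : ∀ m t, W m t = if ∑ l, t l ≤ τ then
        M / (((n : ℝ) + 1) * τ) * (τ - ∑ l, t l + ((n : ℝ) + 1) * t m)
      else M / ∑ j ∈ Finset.range (n + 1),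
        (if t m + (j : ℝ) * (∑ l, t l - (1 - ε)) ≤ ∑ l, t l then (1 : ℝ) else 0))
    {t : Fin (n + 1) → ℝ} (ht : ∀ j, 0 ≤ t j) {m : Fin (n + 1)} (htm : 0 < t m) : 0 < W m t := by
  rw [hW]
  split_ifs with h
  · have : 0 < ((n : ℝ) + 1) * t m := by positivity
    exact mul_pos (by positivity) (by linarith)
  · have htσ : t m ≤ ∑ l, t l :=
      Finset.single_le_sum (f := t) (fun j _ => ht j) (Finset.mem_univ m)
    exact div_pos hM (lt_of_lt_of_le one_pos (one_le_count (by omega) htσ _))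

/-- The weights are measurable (piecewise: an affine function and the reciprocal of a finite sum of
indicators of closed half-spaces). [folklore] -/
theorem measurable_weight {n : ℕ} {ε τ M : ℝ} (W : Fin (n + 1) → (Fin (n + 1) → ℝ) → ℝ)
    (hW : ∀ m t, W m t = if ∑ l, t l ≤ τ then
        M / (((n : ℝ) + 1) * τ) * (τ - ∑ l, t l + ((n : ℝ) + 1) * t m)
      else M / ∑ j ∈ Finset.range (n + 1),
        (if t m + (j : ℝ) * (∑ l, t l - (1 - ε)) ≤ ∑ l, t l then (1 : ℝ) else 0))
    (m : Fin (n + 1)) : Measurable (W m) := by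
  have hσ : Measurable fun t : Fin (n + 1) → ℝ => ∑ l, t l :=
    (continuous_finsetSum _ fun l _ => continuous_apply l).measurable
  have htm : Measurable fun t : Fin (n + 1) → ℝ => t m := measurable_pi_apply m
  have h : W m = fun t => if ∑ l, t l ≤ τ then
        M / (((n : ℝ) + 1) * τ) * (τ - ∑ l, t l + ((n : ℝ) + 1) * t m)
      else M / ∑ j ∈ Finset.range (n + 1),
        (if t m + (j : ℝ) * (∑ l, t l - (1 - ε)) ≤ ∑ l, t l then (1 : ℝ) else 0) := funext (hW m)
  rw [h]
  refine Measurable.ite (measurableSet_le hσ measurable_const) ?_ ?_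
  · exact measurable_const.mul ((measurable_const.sub hσ).add (measurable_const.mul htm))
  · refine measurable_const.div (Finset.measurable_sum _ fun j _ => ?_)
    exact Measurable.ite (measurableSet_le (htm.add (measurable_const.mul (hσ.sub measurable_const)))
      hσ) measurable_const measurable_const

/-! ### The fibre budget -/

/-- **Fibre budget of the two-zone weights.**  For an outer point `s ≥ 0` with `ρ := ∑ s ≤ 1 - ε` and
`1 - ε ≤ τ ≤ 1`, `0 ≤ ε`, the fibre `u ∈ (0, 1+ε-ρ]` of coordinate `m` has
`∫ du / w_m ≤ (1/M) · T`, `T = (k τ log k)/(k-1) + (1+ε-τ) + ∑_{j=1}^{k-1} (min(2ε,(1-ε)/j) - (τ-1+ε))₊`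
(`k = n + 1 ≥ 2`): zone 1 is `MaynardTao.integral_inv_add_mul`, and on the counting zone the `j`-th indicator
is supported on `u ≤ τ - ρ + ℓ_j`. [cite: Polymath8b2014, Proposition 6.5 (proof, completed)] -/
theorem lintegral_weight_inv_le {n : ℕ} (hn : 1 ≤ n) {ε τ M : ℝ} (hM : 0 < M) (hε0 : 0 ≤ ε)
    (hητ : 1 - ε ≤ τ) (hτ1 : τ ≤ 1)
    (W : Fin (n + 1) → (Fin (n + 1) → ℝ) → ℝ)
    (hW : ∀ m t, W m t = if ∑ l, t l ≤ τ then
        M / (((n : ℝ) + 1) * τ) * (τ - ∑ l, t l + ((n : ℝ) + 1) * t m)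
      else M / ∑ j ∈ Finset.range (n + 1),
        (if t m + (j : ℝ) * (∑ l, t l - (1 - ε)) ≤ ∑ l, t l then (1 : ℝ) else 0))
    (m : Fin (n + 1)) {s : Fin n → ℝ} (hs : ∀ j, 0 ≤ s j) (hsρ : ∑ j, s j ≤ 1 - ε) :
    ∫⁻ u in Ioc (0:ℝ) (1 + ε - ∑ j, s j), ENNReal.ofReal (W m (Fin.insertNth m u s))⁻¹ ≤
      ENNReal.ofReal ((1 / M) * (((n : ℝ) + 1) * τ * Real.log ((n : ℝ) + 1) / n + (1 + ε - τ) +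
        ∑ i ∈ Finset.range n, max 0 (min (2 * ε) ((1 - ε) / ((i : ℝ) + 1)) - (τ - (1 - ε))))) := by
  set ρ := ∑ j, s j with hρ
  set L := 1 + ε - ρ with hL
  set a := τ - ρ with ha
  have hK : (0 : ℝ) < n := by exact_mod_cast hn
  have hρ0 : 0 ≤ ρ := Finset.sum_nonneg fun j _ => hs j
  have ha0 : 0 ≤ a := by rw [ha]; linarith
  have haL : a ≤ L := by rw [ha, hL]; linarith
  have hτ0 : 0 ≤ τ := by linarith
  -- the weight along the fibre
  have hσ : ∀ u, ∑ l, (Fin.insertNth m u s : Fin (n + 1) → ℝ) l = u + ρ := fun u =>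
    Fin.sum_insertNth m u s
  have hWfib : ∀ u, W m (Fin.insertNth m u s) = if u + ρ ≤ τ then
        M / (((n : ℝ) + 1) * τ) * (a + (n : ℝ) * u)
      else M / ∑ j ∈ Finset.range (n + 1),
        (if u + (j : ℝ) * (u + ρ - (1 - ε)) ≤ u + ρ then (1 : ℝ) else 0) := by
    intro u
    rw [hW, hσ, Fin.insertNth_apply_same]
    split_ifs
    · rw [ha]; ring
    · rfl
  -- split the fibre at `a = τ - ρ`
  have hsplit : Ioc (0:ℝ) L = Ioc 0 a ∪ Ioc a L := (Ioc_union_Ioc_eq_Ioc ha0 haL).symm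
  rw [hsplit]
  refine (lintegral_union_le _ _ _).trans ?_
  -- zone 1
  have hzone1 : ∫⁻ u in Ioc (0:ℝ) a, ENNReal.ofReal (W m (Fin.insertNth m u s))⁻¹ ≤
      ENNReal.ofReal ((1 / M) * (((n : ℝ) + 1) * τ * Real.log ((n : ℝ) + 1) / n)) := by
    rcases ha0.eq_or_lt with ha00 | ha_pos
    · rw [← ha00, Set.Ioc_self, Measure.restrict_empty, lintegral_zero_measure]; exact zero_le
    have hc0 : 0 ≤ ((n : ℝ) + 1) * τ / M := by positivity
    have hint : IntegrableOn (fun u => ((n : ℝ) + 1) * τ / M * (a + n * u)⁻¹) (Ioc 0 a) := by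
      have hc : ContinuousOn (fun u => ((n : ℝ) + 1) * τ / M * (a + n * u)⁻¹) (Icc 0 a) :=
        ContinuousOn.mul continuousOn_const
          (ContinuousOn.inv₀ (by fun_prop) fun u hu => by have := hu.1; positivity)
      exact hc.integrableOn_Icc.mono_set Ioc_subset_Icc_self
    refine le_of_eq ?_
    calc ∫⁻ u in Ioc (0:ℝ) a, ENNReal.ofReal (W m (Fin.insertNth m u s))⁻¹
        = ∫⁻ u in Ioc (0:ℝ) a, ENNReal.ofReal (((n : ℝ) + 1) * τ / M * (a + n * u)⁻¹) := by
          refine setLIntegral_congr_fun measurableSet_Ioc fun u hu => ?_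
          have hu1 : u + ρ ≤ τ := by rw [ha] at hu; linarith [hu.2]
          rw [hWfib, if_pos hu1, mul_inv, inv_div]
      _ = ENNReal.ofReal (∫ u in Ioc (0:ℝ) a, ((n : ℝ) + 1) * τ / M * (a + n * u)⁻¹) := by
          refine (ofReal_integral_eq_lintegral_ofReal hint ?_).symm
          refine (ae_restrict_iff' measurableSet_Ioc).2 (ae_of_all _ fun u hu => ?_)
          have := hu.1
          simp only [Pi.zero_apply]
          positivity
      _ = ENNReal.ofReal ((1 / M) * (((n : ℝ) + 1) * τ * Real.log ((n : ℝ) + 1) / n)) := by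
          rw [integral_const_mul, ← intervalIntegral.integral_of_le ha_pos.le,
            MaynardTao.integral_inv_add_mul ha_pos hK]
          congr 1
          field_simp
  -- counting zone: the `j`-th indicator lives on `u ≤ a + ℓ_j`
  set ℓ : ℕ → ℝ := fun j => if j = 0 then 1 + ε - τ
      else max 0 (min (2 * ε) ((1 - ε) / j) - (τ - (1 - ε))) with hℓ
  have hℓ0 : ∀ j, 0 ≤ ℓ j := fun j => by
    rw [hℓ]; dsimp only; split_ifs
    · linarith
    · exact le_max_left _ _
  have hind : ∀ u ∈ Ioc a L, ∀ j ∈ Finset.range (n + 1),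
      (if u + (j : ℝ) * (u + ρ - (1 - ε)) ≤ u + ρ then (1 : ℝ) else 0) ≤
        (Iic (a + ℓ j)).indicator (fun _ => (1 : ℝ)) u := by
    intro u hu j _
    by_cases hc : u + (j : ℝ) * (u + ρ - (1 - ε)) ≤ u + ρ
    · rw [if_pos hc]
      have hmem : u ∈ Iic (a + ℓ j) := by
        rw [Set.mem_Iic, hℓ]
        dsimp only
        split_ifs with hj
        · rw [ha]; linarith [hu.2]
        · have hj1 : (1 : ℝ) ≤ j := by exact_mod_cast Nat.one_le_iff_ne_zero.2 hj
          have hv0 : 0 < u + ρ - (1 - ε) := by rw [ha] at hu; linarith [hu.1]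
          have h1 : u + ρ - (1 - ε) ≤ 2 * ε := by rw [hL] at hu; linarith [hu.2]
          have h2 : u + ρ - (1 - ε) ≤ (1 - ε) / j := by
            rw [le_div_iff₀ (by linarith), mul_comm]; linarith
          have h3 : u + ρ - (1 - ε) ≤ min (2 * ε) ((1 - ε) / j) := le_min h1 h2
          have h4 : min (2 * ε) ((1 - ε) / ↑j) - (τ - (1 - ε)) ≤
              max 0 (min (2 * ε) ((1 - ε) / ↑j) - (τ - (1 - ε))) := le_max_right _ _
          rw [ha]; linarith
      rw [Set.indicator_of_mem hmem]
    · rw [if_neg hc]; exact Set.indicator_nonneg (fun _ _ => zero_le_one) u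
  have hzone2 : ∫⁻ u in Ioc a L, ENNReal.ofReal (W m (Fin.insertNth m u s))⁻¹ ≤
      ENNReal.ofReal ((1 / M) * ∑ j ∈ Finset.range (n + 1), ℓ j) := by
    calc ∫⁻ u in Ioc a L, ENNReal.ofReal (W m (Fin.insertNth m u s))⁻¹
        ≤ ∫⁻ u in Ioc a L, ∑ j ∈ Finset.range (n + 1),
            (Iic (a + ℓ j)).indicator (fun _ => ENNReal.ofReal (1 / M)) u := by
          refine setLIntegral_mono' measurableSet_Ioc fun u hu => ?_
          have hu1 : ¬ (u + ρ ≤ τ) := by rw [ha] at hu; linarith [hu.1]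
          rw [hWfib, if_neg hu1, inv_div, div_eq_mul_inv, Finset.sum_mul, ← one_div]
          calc ENNReal.ofReal (∑ j ∈ Finset.range (n + 1),
                (if u + (j : ℝ) * (u + ρ - (1 - ε)) ≤ u + ρ then (1 : ℝ) else 0) * (1 / M))
              ≤ ENNReal.ofReal (∑ j ∈ Finset.range (n + 1),
                  (Iic (a + ℓ j)).indicator (fun _ => (1 : ℝ)) u * (1 / M)) := by
                refine ENNReal.ofReal_le_ofReal (Finset.sum_le_sum fun j hj => ?_)
                exact mul_le_mul_of_nonneg_right (hind u hu j hj) (by positivity)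
            _ = ∑ j ∈ Finset.range (n + 1),
                  (Iic (a + ℓ j)).indicator (fun _ => ENNReal.ofReal (1 / M)) u := by
                rw [ENNReal.ofReal_sum_of_nonneg fun j _ => mul_nonneg
                  (Set.indicator_nonneg (fun _ _ => zero_le_one) u) (by positivity)]
                refine Finset.sum_congr rfl fun j _ => ?_
                by_cases hmem : u ∈ Iic (a + ℓ j)
                · simp [Set.indicator_of_mem hmem]
                · simp [Set.indicator_of_notMem hmem]
      _ = ∑ j ∈ Finset.range (n + 1), ∫⁻ u in Ioc a L,
            (Iic (a + ℓ j)).indicator (fun _ => ENNReal.ofReal (1 / M)) u :=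
          lintegral_finsetSum _ fun j _ => measurable_const.indicator measurableSet_Iic
      _ ≤ ∑ j ∈ Finset.range (n + 1), ENNReal.ofReal (1 / M) * ENNReal.ofReal (ℓ j) := by
          refine Finset.sum_le_sum fun j _ => ?_
          rw [lintegral_indicator measurableSet_Iic, setLIntegral_const,
            Measure.restrict_apply measurableSet_Iic]
          refine mul_le_mul' le_rfl ?_
          calc volume (Iic (a + ℓ j) ∩ Ioc a L) ≤ volume (Ioc a (a + ℓ j)) :=
                measure_mono fun u hu => ⟨hu.2.1, hu.1⟩
            _ = ENNReal.ofReal (ℓ j) := by rw [Real.volume_Ioc]; ring_nf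
      _ = ENNReal.ofReal ((1 / M) * ∑ j ∈ Finset.range (n + 1), ℓ j) := by
          rw [← Finset.mul_sum, ENNReal.ofReal_mul (by positivity),
            ENNReal.ofReal_sum_of_nonneg fun j _ => hℓ0 j]
  -- add up
  refine (add_le_add hzone1 hzone2).trans ?_
  rw [← ENNReal.ofReal_add, ← mul_add]
  · refine ENNReal.ofReal_le_ofReal (le_of_eq ?_)
    congr 1
    have h0 : ℓ 0 = 1 + ε - τ := by rw [hℓ]; simp
    have hS : ∑ i ∈ Finset.range n, ℓ (i + 1) =
        ∑ i ∈ Finset.range n, max 0 (min (2 * ε) ((1 - ε) / ((i : ℝ) + 1)) - (τ - (1 - ε))) := by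
      refine Finset.sum_congr rfl fun i _ => ?_
      rw [hℓ]; dsimp only
      rw [if_neg (Nat.succ_ne_zero i)]
      push_cast
      ring_nf
    rw [Finset.sum_range_succ' (fun j => ℓ j) n, h0, hS]
    ring
  · have : 0 ≤ Real.log ((n : ℝ) + 1) := Real.log_nonneg (by linarith)
    positivity
  · exact mul_nonneg (by positivity) (Finset.sum_nonneg fun j _ => hℓ0 j)

end MkEps

/-! ### The bound `M_{k,ε} ≤ T_k(ε, τ)` -/

open MkEps in
/-- **Polymath 8b Proposition 6.5, completed form: `M_{k,ε} ≤ T_k(ε,τ)` for every threshold `τ ∈ [1-ε, 1]`.**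
For `k = n+1 ≥ 2`, `0 ≤ ε < 1`, `1 - ε ≤ τ ≤ 1` and every test function `F` of Theorem 3.12,
`(∑ᵢ J_{i,1-ε}(F))/I(F) ≤ (k/(k-1)) τ log k + (1 + ε - τ) + ∑_{j=1}^{k-1} (min(2ε, (1-ε)/j) - (τ - 1 + ε))₊`.
(`τ = 1`, `ε = 0` is Corollary 6.4: `M_k ≤ (k/(k-1)) log k`.)  Proof: `polymathFunctional_le_of_weights` with
the two-zone weights of the module docstring. [cite: Polymath8b2014, Proposition 6.5 and Corollary 6.4] -/
theorem polymathFunctional_le_epsT {n : ℕ} (hn : 1 ≤ n) {ε τ : ℝ} (hε0 : 0 ≤ ε) (hε1 : ε < 1)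
    (hητ : 1 - ε ≤ τ) (hτ1 : τ ≤ 1) {F : (Fin (n + 1) → ℝ) → ℝ} (hF : IsPolymathTestFunction (n + 1) ε F) :
    polymathFunctional (n + 1) ε F ≤
      ((n : ℝ) + 1) * τ * Real.log ((n : ℝ) + 1) / n + (1 + ε - τ) +
        ∑ i ∈ Finset.range n, max 0 (min (2 * ε) ((1 - ε) / ((i : ℝ) + 1)) - (τ - (1 - ε))) := by
  set M := ((n : ℝ) + 1) * τ * Real.log ((n : ℝ) + 1) / n + (1 + ε - τ) +
        ∑ i ∈ Finset.range n, max 0 (min (2 * ε) ((1 - ε) / ((i : ℝ) + 1)) - (τ - (1 - ε))) with hMdef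
  have hτ0 : 0 < τ := by linarith
  have hK : (0 : ℝ) < n := by exact_mod_cast hn
  have hM : 0 < M := by
    have h1 : 0 < ((n : ℝ) + 1) * τ * Real.log ((n : ℝ) + 1) / n := by
      have : 0 < Real.log ((n : ℝ) + 1) := Real.log_pos (by linarith)
      positivity
    have h2 : 0 ≤ ∑ i ∈ Finset.range n,
        max 0 (min (2 * ε) ((1 - ε) / ((i : ℝ) + 1)) - (τ - (1 - ε))) :=
      Finset.sum_nonneg fun i _ => le_max_left _ _
    linarith
  obtain ⟨W, hW⟩ : ∃ W : Fin (n + 1) → (Fin (n + 1) → ℝ) → ℝ, ∀ m t, W m t =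
      if ∑ l, t l ≤ τ then M / (((n : ℝ) + 1) * τ) * (τ - ∑ l, t l + ((n : ℝ) + 1) * t m)
      else M / ∑ j ∈ Finset.range (n + 1),
        (if t m + (j : ℝ) * (∑ l, t l - (1 - ε)) ≤ ∑ l, t l then (1 : ℝ) else 0) :=
    ⟨_, fun _ _ => rfl⟩
  refine polymathFunctional_le_of_weights hM.le hF W (measurable_weight W hW) ?_ ?_ ?_
  · intro m t hFt htm _
    have ht : t ∈ scaledSimplex (n + 1) (1 + ε) := hF.support_subset (Function.mem_support.2 hFt)
    exact weight_pos hM hτ0 W hW ht.1 htm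
  · intro m s hs hsρ
    refine (lintegral_weight_inv_le hn hM hε0 hητ hτ1 W hW m hs hsρ).trans ?_
    rw [← hMdef, one_div_mul_cancel hM.ne', ENNReal.ofReal_one]
  · intro t ht _
    exact sum_weight_le hM hτ0 hητ W hW ht

end Literature.NumberTheory.Sieve
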